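import Summits.HodgeConjecture.HodgeConjecture.Theorems.R90S10ThetaLineOfChar               -- ★ p864796 (p05): `charLine_occurs_linked_multOne`, `smoothTrace_charClass_eq_integral` (abstract line `Θ`, `θloc`)
import Summits.HodgeConjecture.HodgeConjecture.Theorems.R90S10AutCharUnramifiedSplit       -- ★ p864835 (p05) (F): `apply_eq_apply_archToAdelic_mul_local_of_unramified`
import Summits.HodgeConjecture.HodgeConjecture.Theorems.R90S10ThetaLineClassTraceEuler     -- p864900 (this seat) §3: `exists_isHaarMeasure_classTrace_mk_ofChar_inv_eq_integral_mul_integral`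
import Summits.HodgeConjecture.HodgeConjecture.Theorems.R90S10ThetaLineEulerBridge         -- p864901 (this seat): `mul_finprod_indicator_toLocal_eq`, `mul_finprod_indicator_toLocal_eq_zero`
import Literature.NumberTheory.Automorphic.UnitaryGroupArchTopology                        -- ★ instance `LocallyCompactSpace` on `UnitaryGroup.arch …` (a Haar measure on `H1Arch L`)
import HarnessLib

/-!
# R90-TF · S10 (Rogawski 1990 §13.8) · THEOREMS — `R90S10ThetaLineTracePin`: THE θ-LINE's GLOBAL TRACE PIN `hθi` (+ (C-ii) `ν₁i χi`, R10) FOR AN ABSTRACT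
# AUTOMORPHIC CHARACTER LINE — unconditional (the one-place Euler factor is ★ `R90S10ThetaLineClassTraceEuler` §3)

Cell hodgecm-mathlib, slab R90-TF, section S10 = §13.8, crux item h413 = stmt-HodgeConjecture-24833 (route `route-HodgeConjecture-HCCMUnconditional`).  Prover seat
LH7-p07 (g3), DEAL #66 (S10 dealer R90-C138-plan (g3), 2026-09-05T03:07Z): TAKE OVER (C-iii-3) from R90-C138-p05 (g0)'s draft `R90S10ThetaLineTracePin.draft.8353f31c1ec21112.lean`
(census `CENSUS-40b-thetaLineGlobal.md` d666bc68; RULING J-θ (β′): the θ-line of record is an ABSTRACT automorphic character `Θ` of `U(Φ₁)(𝔸)` with local components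
`θloc`, pins `hθv`∕`hθunr`) and REBASE it on the Euler brick: p05's hypothesis `hE` («DEAL #58's one-place Euler factor») is DISCHARGED by ★ `R90S10ThetaLineClassTraceEuler`
§3 `exists_isHaarMeasure_classTrace_mk_ofChar_inv_eq_integral_mul_integral` (constants absorbed into the free Haar measure `ν₁`), so the theorem below has NO measure-theoretic
hypothesis left.  HEAD: THE FIELD `hθi` OF ★ `S10HDatum` (★ `R90S10FrozenDatumDefs` :407–:414) for the line `d₁ := mk (ofChar Θ⁻¹ μ₁)` of ★ `charLine_occurs_linked_multOne`,
in p01's ∀-over-`K₁` shape (= the `hθi` conjunct of p01's `hC`, ★ p864804 :191–:226), BYTES OF p05's DRAFT HEAD VERBATIM: for every `g_∞`, locally smooth `g_v` and every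
freezing map `Φ₁` pinned pointwise to `g_∞ ⊗ g_v ⊗ 𝟙_{K₁^v}` (standard levels off `v`),
`Tr θ(Φ₁ g_v) = m(θ) · (∫ g_∞ θ_∞ dν₁i) · Tr θ_v(g_v)` — with the Haar measures `ν₁` (on `U(Φ₁)(𝔸)`) and `ν₁i` (on `U(Φ₁)_∞`) and `χi := θ_∞ = Θ ∘ archToAdelic`
PRODUCED here (fields `ν₁ [hν₁] ν₁i χi` + R10 `Continuous χi ∧ IsFiniteMeasureOnCompacts ν₁i`).

PRINT → PROOF (Rogawski 1990 §13.8 p. 219 L1–2 «`Tr ρ(f^H) = … ∫ θ …`»; [Gelbart1975, §2.A]; [BorelJacquet1979, §4.1]; [TateThesis1967, Thm. 3.3.1]).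
(1) ON THE UNRAMIFIED BOX `{z | z_w ∈ K₁ w, w ≠ v}` the frozen function is `g_∞(z_∞) · g_v(z_v)` and OFF it `0` (★ bridge `mul_finprod_indicator_toLocal_eq`∕`_eq_zero`:
finitely many non-integral coordinates); (2) on that box `Θ(z) = Θ((z_∞, 1)) · θloc_v(z_v)` (★ (F) `apply_eq_apply_archToAdelic_mul_local_of_unramified`, from `hθunr` + `hΘ`);
(3) hence ★ §3 (class trace of the character line `ℂ[Θ]` against the pure tensor `g_∞ ⊗ g_v ⊗ ⊗_{w≠v} 1_{K₁ w}`, constants absorbed into `ν₁`):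
`Tr θ(Φ₁ g_v) = (∫ g_∞ · (Θ ∘ archToAdelic) dν₁i) · ∫ g_v θloc_v dν₁v`; (4) `∫ g_v θloc_v dν₁v = Tr θ_v(g_v)` (★ `smoothTrace_charClass_eq_integral`) and `m(θ) = 1`
(★ `charLine_occurs_linked_multOne`).  `ν₁i := haar` on `U(Φ₁)(L⁺ ⊗ ℝ)` (★ `instLocallyCompactSpaceArch`), `χi := Θ ∘ archToAdelic` (continuous: `Θ.continuous ∘ continuous_archToAdelic`).

CONTENTS (one theorem; no `def`, no `instance`, no `notation`, no `sorry`; axioms ⊆ {propext, Classical.choice, Quot.sound}).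
* **`thetaLine_tracePin_of_char`** — `∃ ν₁ (_ : Haar) ν₁i (_ : Haar) χi, χi = Θ ∘ archToAdelic ∧ Continuous χi ∧ IsFiniteMeasureOnCompacts ν₁i ∧ ‹hθi's body VERBATIM at
  θ v := ⟦ℂ_{θloc v}⟧, d₁ := mk (ofChar Θ⁻¹ μ₁)›`, hypotheses `(Θ) (θloc) (hθo) (hΘ) (hθunr) (K₁) (hK₁std)` ONLY (p05's draft head minus `hE`).

HONEST LABEL: pays no socket by itself; the EXISTENCE of `(Θ, θloc)` with the J-θ pins for the crux's `ξ` is the residual letter L-C′ (`TorusCharExtendLetter`); this file is the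
(C-iii-3) supplier of p02 (g2)'s block-C conductor `thetaBlockC_of_torusCharExtendLetter`.  HC_CM is proved only modulo the 7 printed citations (2 remaining named inputs: hLiu418 =
stmt-HodgeConjecture-24832, h413 = stmt-HodgeConjecture-24833) until rung 0 closes; count-neutral helper; REL ≠ ★ ≠ BUILT.  Namespace `Summit.HodgeConjecture.HodgeConjecture.R90.S10`.

## References
* [Rogawski1990] J. D. Rogawski, *Automorphic Representations of Unitary Groups in Three Variables*, Ann. of Math. Stud. 123 (1990), §13.8 p. 218 L9–10, p. 219 L1–2; §13.3 pp. 202–203.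
* [Gelbart1975] S. Gelbart, *Automorphic forms on adele groups*, Ann. of Math. Stud. 83 (1975), §2.A.
* [BorelJacquet1979] A. Borel, H. Jacquet, *Automorphic forms and automorphic representations*, PSPM 33.1 (1979), §4.1.
* [TateThesis1967] J. Tate, *Fourier analysis in number fields and Hecke's zeta-functions*, in Cassels–Fröhlich (1967), Ch. XV §3.2–3.3, Thm. 3.3.1.
-/

set_option autoImplicit false
-- the mandated namespace repeats the single-problem summit's segment (`HodgeConjecture.HodgeConjecture`)
set_option linter.dupNamespace false

noncomputable section

open NumberField IsDedekindDomain MeasureTheory Topology Filter CompactlySupported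
open scoped Matrix NNReal ENNReal
open Literature.NumberTheory Literature.NumberTheory.Automorphic Literature.NumberTheory.Automorphic.UnitaryGroup
open Literature.NumberTheory.Rogawski1990 Literature.NumberTheory.GaloisRepresentations
open Summit.HodgeConjecture.HodgeConjecture.Cruxes.H413
open Summit.HodgeConjecture.HodgeConjecture.Cruxes.H413.F0P3GlobalPacketDiscrete
open Summit.HodgeConjecture.HodgeConjecture.Cruxes.H413.K2E1TraceFormulaBeta (Pl)
open Summit.HodgeConjecture.HodgeConjecture.Cruxes.H413.K2E1SpectralTermsDiscreteHalf

namespace Summit.HodgeConjecture.HodgeConjecture.R90.S10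

variable (L : Type) [Field L] [NumberField L] [IsCMField L]

/-- **THE θ-LINE's GLOBAL TRACE PIN (`hθi`) + `ν₁ ν₁i χi` + R10 — UNCONDITIONAL.**  For an automorphic character `Θ` of `U(Φ₁)(𝔸)` with local components `θloc` (`hΘ`), UNRAMIFIED
OFF `v` (`hθunr : θloc w = 1` on `U(Φ₁)(𝒪_w)`, `w ≠ v`), a Haar measure `ν₁v` on `U(Φ₁)(L⁺_v)` and the standard level family off `v` (`hK₁std`): there are Haar measures `ν₁` on
`U(Φ₁)(𝔸)`, `ν₁i` on `U(Φ₁)_∞` and `χi = Θ ∘ archToAdelic` (continuous) such that, for `d₁ := mk (ofChar Θ⁻¹ μ₁)` and `θ_v := ⟦ℂ_{θloc v}⟧`,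
`d₁.classTrace ν₁ (Φ₁ g_v) = m(d₁) · (∫ g_∞ χi dν₁i) · Tr θ_v(g_v)` for every `g_∞`, locally smooth `g_v` and freezing map `Φ₁` pinned to `g_∞ ⊗ g_v ⊗ 𝟙_{K₁^v}` — ★ `S10HDatum.hθi`'s
body token for token (★ Euler brick §3 + ★ bridge + ★ (F) + ★ R4′). [cite: Rogawski1990, §13.8 p. 219 L1–2; §13.3 pp. 202–203] [cite: Gelbart1975, §2.A] [cite: BorelJacquet1979, §4.1]
[cite: TateThesis1967, Thm. 3.3.1] -/
theorem thetaLine_tracePin_of_char (v : Pl L)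
    [MeasurableSpace (H1Loc L v)] [BorelSpace (H1Loc L v)]
    [MeasurableSpace (H1 L).Adelic] [BorelSpace (H1 L).Adelic] [MeasurableSpace (H1Arch L)] [BorelSpace (H1Arch L)]
    (μ₁ : Measure (H1 L).automorphicQuotient) [(H1 L).IsAutomorphicMeasure μ₁]
    (ν₁v : Measure (H1Loc L v)) [ν₁v.IsHaarMeasure]
    (Θ : (H1 L).AutomorphicCharacter) (θloc : ∀ w : Pl L, H1Loc L w →* ℂˣ)
    (hθo : ∀ w : Pl L, IsOpen ((((θloc w).ker : Subgroup (H1Loc L w))) : Set (H1Loc L w)))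
    (hΘ : ∀ (w : Pl L) (u : localPi L (IsCMField.complexConj L) 1 (Matrix.of fun i j : Fin 1 => if i.val + j.val + 1 = 1 then (1 : L) else 0) w),
      θloc w (localPiEquiv L (IsCMField.complexConj L) 1 (Matrix.of fun i j : Fin 1 => if i.val + j.val + 1 = 1 then (1 : L) else 0) w u) =
        Θ (inclPlaceAdelic (↥(maximalRealSubfield L)) L (IsCMField.complexConj L) 1 (Matrix.of fun i j : Fin 1 => if i.val + j.val + 1 = 1 then (1 : L) else 0) w u))
    (hθunr : ∀ w : Pl L, w ≠ v → ∀ k : H1Loc L w,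
      k ∈ cmLocalIntegralLevel L 1 (Matrix.of fun i j : Fin 1 => if i.val + j.val + 1 = 1 then (1 : L) else 0) w → θloc w k = 1)
    (K₁ : ∀ w : Pl L, Subgroup (H1Loc L w))
    (hK₁std : ∀ w : Pl L, w ≠ v → K₁ w = cmLocalIntegralLevel L 1 (Matrix.of fun i j : Fin 1 => if i.val + j.val + 1 = 1 then (1 : L) else 0) w) :
    ∃ (ν₁ : Measure (H1 L).Adelic) (_ : ν₁.IsHaarMeasure) (ν₁i : Measure (H1Arch L)) (_ : ν₁i.IsHaarMeasure) (χi : H1Arch L → ℂ),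
      (χi = fun a => ((Θ (archToAdelic (↥(maximalRealSubfield L)) L (IsCMField.complexConj L) 1 (Matrix.of fun i j : Fin 1 => if i.val + j.val + 1 = 1 then (1 : L) else 0) a) : ℂˣ) : ℂ)) ∧
      Continuous χi ∧ IsFiniteMeasureOnCompacts ν₁i ∧
      ∀ (gi : H1Arch L → ℂ) (gv : H1Loc L v → ℂ), ArchSmooth L 1 (Matrix.of fun i j : Fin 1 => if i.val + j.val + 1 = 1 then (1 : L) else 0) gi → IsLocSmooth gv →
        ∀ (Φ₁ : (H1Loc L v → ℂ) → C_c((H1 L).Adelic, ℂ)),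
          (∀ g₁ : H1Loc L v → ℂ, IsLocSmooth g₁ → ∀ z : (H1 L).Adelic,
            Φ₁ g₁ z = gi (UnitaryGroup.archPart (↥(maximalRealSubfield L)) L (IsCMField.complexConj L) 1
                (Matrix.of fun i j : Fin 1 => if i.val + j.val + 1 = 1 then (1 : L) else 0) z) *
              (g₁ ((H1 L).toLocal v z) *
                ∏ᶠ w : {w : Pl L // w ≠ v}, Set.indicator (K₁ w.1 : Set (H1Loc L w.1)) (fun _ => (1 : ℂ)) ((H1 L).toLocal w.1 z))) →
          (DiscreteClass.mk (DiscreteAutomorphicRep.ofChar Θ⁻¹ μ₁)).classTrace ν₁ (Φ₁ gv) =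
            (((DiscreteClass.mk (DiscreteAutomorphicRep.ofChar Θ⁻¹ μ₁)).mult).toNat : ℂ) * (∫ z, gi z * χi z ∂ν₁i) *
              (IrrClass.mk (SmoothIrrep.ofChar (θloc v) (hθo v))).smoothTrace ν₁v gv := by
  classical
  -- a Haar measure on `U(Φ₁)(L⁺ ⊗ ℝ)` and the Euler brick's normalised Haar measure `ν₁` on `U(Φ₁)(𝔸)`
  let ν₁i : Measure (H1Arch L) := Measure.haar
  obtain ⟨ν₁, hν₁, hE⟩ := exists_isHaarMeasure_classTrace_mk_ofChar_inv_eq_integral_mul_integral (L := L) (N := 1)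
    (H := Matrix.of fun i j : Fin 1 => if i.val + j.val + 1 = 1 then (1 : L) else 0) v ν₁i ν₁v
  refine ⟨ν₁, hν₁, ν₁i, inferInstance, _, rfl,
    Θ.continuous.comp (continuous_archToAdelic (↥(maximalRealSubfield L)) L (IsCMField.complexConj L) 1 (Matrix.of fun i j : Fin 1 => if i.val + j.val + 1 = 1 then (1 : L) else 0)),
    inferInstance, ?_⟩
  intro gi gv _hgi hgv Φ₁ hΦ
  -- (1) the frozen function ON ∕ OFF the box `{z | z_w ∈ K₁ w, w ≠ v}` (★ bridge)
  have hF₁ : ∀ z : (H1 L).Adelic, (∀ w : Pl L, w ≠ v → (H1 L).toLocal w z ∈ K₁ w) →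
      Φ₁ gv z = gi (UnitaryGroup.archPart (↥(maximalRealSubfield L)) L (IsCMField.complexConj L) 1
        (Matrix.of fun i j : Fin 1 => if i.val + j.val + 1 = 1 then (1 : L) else 0) z) * gv ((H1 L).toLocal v z) := fun z hz => by
    rw [hΦ gv hgv z]
    exact mul_finprod_indicator_toLocal_eq v K₁ z hz _ _
  have hF₀ : ∀ z : (H1 L).Adelic, (¬ ∀ w : Pl L, w ≠ v → (H1 L).toLocal w z ∈ K₁ w) → Φ₁ gv z = 0 := fun z hz => by
    rw [hΦ gv hgv z]
    exact mul_finprod_indicator_toLocal_eq_zero v K₁ hK₁std z hz _ _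
  -- (2) `Θ` factorises on the box (★ (F)): the unramified hypothesis in the `localPi` model, the box read on the finite part
  have hunr' : ∀ w : Pl L, w ≠ v → ∀ u : localPi L (IsCMField.complexConj L) 1 (Matrix.of fun i j : Fin 1 => if i.val + j.val + 1 = 1 then (1 : L) else 0) w,
      u ∈ localInt L (IsCMField.complexConj L) 1 (Matrix.of fun i j : Fin 1 => if i.val + j.val + 1 = 1 then (1 : L) else 0) w →
        Θ.toMonoidHom (inclPlaceAdelic (↥(maximalRealSubfield L)) L (IsCMField.complexConj L) 1 (Matrix.of fun i j : Fin 1 => if i.val + j.val + 1 = 1 then (1 : L) else 0) w u) = 1 := by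
    intro w hw u hu
    have h1 := hθunr w hw (localPiEquiv L (IsCMField.complexConj L) 1 (Matrix.of fun i j : Fin 1 => if i.val + j.val + 1 = 1 then (1 : L) else 0) w u)
      ((localPiEquiv_mem_localIntegralLevel_iff (IsCMField.complexConj L) 1 (Matrix.of fun i j : Fin 1 => if i.val + j.val + 1 = 1 then (1 : L) else 0) w u).2 hu)
    rw [hΘ w u] at h1
    exact h1
  have hKiff : ∀ (w : Pl L), w ≠ v → ∀ z : (H1 L).Adelic,
      (H1 L).toLocal w z ∈ K₁ w ↔ evalPlace (↥(maximalRealSubfield L)) L (IsCMField.complexConj L) 1 (Matrix.of fun i j : Fin 1 => if i.val + j.val + 1 = 1 then (1 : L) else 0) w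
        (finPart (↥(maximalRealSubfield L)) L (IsCMField.complexConj L) 1 (Matrix.of fun i j : Fin 1 => if i.val + j.val + 1 = 1 then (1 : L) else 0) z) ∈
          localInt L (IsCMField.complexConj L) 1 (Matrix.of fun i j : Fin 1 => if i.val + j.val + 1 = 1 then (1 : L) else 0) w := by
    intro w hw z
    rw [hK₁std w hw, ← localPiEquiv_mem_localIntegralLevel_iff (IsCMField.complexConj L) 1 (Matrix.of fun i j : Fin 1 => if i.val + j.val + 1 = 1 then (1 : L) else 0) w,
      localPiEquiv_evalPlace_finPart]
    rfl
  have hΘ' : ∀ z : (H1 L).Adelic, (∀ w : Pl L, w ≠ v → (H1 L).toLocal w z ∈ K₁ w) →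
      ((Θ z : ℂˣ) : ℂ) = (fun a => ((Θ (archToAdelic (↥(maximalRealSubfield L)) L (IsCMField.complexConj L) 1 (Matrix.of fun i j : Fin 1 => if i.val + j.val + 1 = 1 then (1 : L) else 0) a) : ℂˣ) : ℂ))
          (UnitaryGroup.archPart (↥(maximalRealSubfield L)) L (IsCMField.complexConj L) 1 (Matrix.of fun i j : Fin 1 => if i.val + j.val + 1 = 1 then (1 : L) else 0) z) *
        (fun x : H1Loc L v => ((θloc v x : ℂˣ) : ℂ)) ((H1 L).toLocal v z) := fun z hz => by
    have h := apply_eq_apply_archToAdelic_mul_local_of_unramified Θ.toMonoidHom Θ.continuous v (θloc v) (fun u => hΘ v u) hunr' z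
      fun w hw => (hKiff w hw z).1 (hz w hw)
    have h' := congrArg Units.val h
    rw [Units.val_mul] at h'
    exact h'
  -- (3) the Euler brick, (4) multiplicity one and the local trace
  rw [hE μ₁ Θ K₁ hK₁std gi gv (Φ₁ gv) hF₁ hF₀
      (fun a => ((Θ (archToAdelic (↥(maximalRealSubfield L)) L (IsCMField.complexConj L) 1 (Matrix.of fun i j : Fin 1 => if i.val + j.val + 1 = 1 then (1 : L) else 0) a) : ℂˣ) : ℂ))
      (fun x : H1Loc L v => ((θloc v x : ℂˣ) : ℂ)) hΘ',
    (charLine_occurs_linked_multOne L μ₁ Θ θloc hθo hΘ).2.2, ENat.toNat_one, Nat.cast_one, one_mul,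
    smoothTrace_charClass_eq_integral L v (θloc v) (hθo v) ν₁v gv hgv]

end Summit.HodgeConjecture.HodgeConjecture.R90.S10

end
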